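import Mathlib
import Summits.Ventures.HodgeRepro.Tier4.Common.AdelicDefs
import Summits.Ventures.HodgeRepro.Tier4.Line1.PlaneDefs
import Summits.Ventures.HodgeRepro.Tier4.Line1.RationalPoints
import Summits.Ventures.HodgeRepro.Tier4.Line1.LocallyCompactGA
import Summits.Ventures.HodgeRepro.Tier4.Line1.C7Components
import Summits.Ventures.HodgeRepro.Tier4.Line1.C7AdelicBox

/-!
# Tier4/Line1/C7BoxCompact — the adelic box is compact in `U(W)(𝔸_k)` (C7.3b of the C7 census)

Blind re-derivation cell `pub-hodge-repro`, Tier 4, LINE L1, rung C7 (typed census `proofs/t4/L1/C7-rungs-sig.lean`,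
t4-L1-p4 with t4-L1-p2).  `isCompact_adelicBox`: for a definite plane, a finite set `S` of finite places, compact
`Kf v ⊆ M₄(k_v)` (`v ∈ S`) and compact `Ki w ⊆ M₄(k_w)`, the box `{g ∈ GA W : g_w ∈ Ki w, g_v ∈ Kf v (v ∈ S),
g_v ∈ U(W)(𝓞_v) (v ∉ S)}` is compact in the units topology of `GL₄(𝔸_k)`.  Proof: `g ↦ (g, op g⁻¹)` is an inducing
map `GA W → M₄(𝔸_k) × M₄(𝔸_k)ᵐᵒᵖ` with closed range (Mathlib's `Units.isClosedEmbedding_embedProduct` and p5's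
`isClosed_unitaryGroup`); on the local unitary group the inverse is `det h • adj h` with `det h = ±1` (`h B hᵀ = B`,
`det B ≠ 0` from `IsDefinite`), continuous and integral when `h` is, so the box is closed in `GA W` and its image
lies in a product of two compact entrywise boxes (`C7AdelicBox`).  HC_CM is NOT proved by anyone in this repository.
-/

set_option autoImplicit false
noncomputable section
namespace Summit.Ventures.HodgeRepro.Tier4.Line1
open NumberField IsDedekindDomain HeightOneSpectrum Topology Common Matrix Set

section Determinant

variable {k : Type} [Field k] [NumberField k] (W : PlaneData k)

omit [NumberField k] in
/-- For a definite plane the Gram matrix is invertible: `det B ≠ 0`. -/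
theorem det_ne_zero_of_isDefinite (hW : IsDefinite W) : W.B.det ≠ 0 := by
  obtain ⟨σ, hσ⟩ := hW
  have hdet : (W.B.map σ).det ≠ 0 := by
    rcases hσ with h | h
    · exact h.det_pos.ne'
    · have h1 := h.det_pos
      rw [Matrix.det_neg, Fintype.card_fin] at h1
      norm_num at h1
      exact h1.ne'
  intro h0
  apply hdet
  rw [← RingHom.mapMatrix_apply, ← RingHom.map_det, h0, map_zero]

omit [NumberField k] in
/-- The local Gram matrix is invertible. -/
theorem det_map_ne_zero_of_isDefinite {F : Type} [Field F] (f : k →+* F) (hW : IsDefinite W) :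
    (W.B.map f).det ≠ 0 := by
  rw [← RingHom.mapMatrix_apply, ← RingHom.map_det]
  exact (map_ne_zero f).2 (det_ne_zero_of_isDefinite W hW)

omit [NumberField k] in
/-- `det h · det h = 1` for a local unitary matrix `h` (`h B hᵀ = B`, `det B ≠ 0`). -/
theorem det_mul_self_eq_one_of_unitary {F : Type} [Field F] (f : k →+* F) (hB : (W.B.map f).det ≠ 0)
    {h : Matrix (Fin 4) (Fin 4) F} (hh : h * W.B.map f * hᵀ = W.B.map f) : h.det * h.det = 1 := by
  have h1 := congrArg Matrix.det hh
  rw [Matrix.det_mul, Matrix.det_mul, Matrix.det_transpose] at h1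
  have h2 : h.det * h.det * (W.B.map f).det = 1 * (W.B.map f).det := by
    rw [one_mul]
    calc h.det * h.det * (W.B.map f).det = h.det * (W.B.map f).det * h.det := by ring
      _ = (W.B.map f).det := h1
  exact mul_right_cancel₀ hB h2

/-- A matrix with `det h · det h = 1` has inverse `det h • adj h`. -/
theorem inv_eq_det_smul_adjugate {F : Type} [Field F] {h : Matrix (Fin 4) (Fin 4) F}
    (hdet : h.det * h.det = 1) : h⁻¹ = h.det • h.adjugate := by
  rw [Matrix.inv_def, Ring.inverse_eq_inv]
  congr 1
  exact (eq_inv_of_mul_eq_one_left hdet).symm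

/-- The inverse of a local unitary matrix (finite place) is `det h • adj h`. -/
theorem inv_eq_of_mem_localU (hW : IsDefinite W) (v : HeightOneSpectrum (𝓞 k))
    {h : Matrix (Fin 4) (Fin 4) (v.adicCompletion k)} (hh : h ∈ localU W v) :
    h⁻¹ = h.det • h.adjugate :=
  inv_eq_det_smul_adjugate (det_mul_self_eq_one_of_unitary W _ (det_map_ne_zero_of_isDefinite W _ hW) hh.2)

omit [NumberField k] in
/-- The inverse of a local unitary matrix (infinite place) is `det h • adj h`. -/
theorem inv_eq_of_mem_localUInf (hW : IsDefinite W) (w : InfinitePlace k)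
    {h : Matrix (Fin 4) (Fin 4) w.Completion} (hh : h ∈ localUInf W w) :
    h⁻¹ = h.det • h.adjugate :=
  inv_eq_det_smul_adjugate (det_mul_self_eq_one_of_unitary W _ (det_map_ne_zero_of_isDefinite W _ hW) hh.2)

/-- `det h • adj h` has integral entries when `h` has. -/
theorem det_smul_adjugate_mem_integers (v : HeightOneSpectrum (𝓞 k))
    {h : Matrix (Fin 4) (Fin 4) (v.adicCompletion k)} (hint : ∀ i j, h i j ∈ v.adicCompletionIntegers k)
    (i j : Fin 4) : (h.det • h.adjugate) i j ∈ v.adicCompletionIntegers k := by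
  let h' : Matrix (Fin 4) (Fin 4) (v.adicCompletionIntegers k) := fun i j => ⟨h i j, hint i j⟩
  have hh : h = (v.adicCompletionIntegers k).subtype.mapMatrix h' := by
    ext i j
    rfl
  rw [hh, ← RingHom.map_det, ← RingHom.map_adjugate, Matrix.smul_apply, RingHom.mapMatrix_apply,
    Matrix.map_apply, smul_eq_mul, ← map_mul]
  exact SetLike.coe_mem (h'.det * h'.adjugate i j)

end Determinant

section Closed

variable {k : Type} [Field k] [NumberField k] (W : PlaneData k)

/-- The local unitary group at a finite place is closed. -/
theorem isClosed_localU (v : HeightOneSpectrum (𝓞 k)) : IsClosed (localU W v) :=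
  (isClosed_eq (continuous_id.mul continuous_const) (continuous_const.mul continuous_id)).inter
    (isClosed_eq ((continuous_id.mul continuous_const).mul continuous_id.matrix_transpose) continuous_const)

omit [NumberField k] in
/-- The local unitary group at an infinite place is closed. -/
theorem isClosed_localUInf (w : InfinitePlace k) : IsClosed (localUInf W w) :=
  (isClosed_eq (continuous_id.mul continuous_const) (continuous_const.mul continuous_id)).inter
    (isClosed_eq ((continuous_id.mul continuous_const).mul continuous_id.matrix_transpose) continuous_const)

/-- The integral local unitary group is closed. -/
theorem isClosed_localUInt (v : HeightOneSpectrum (𝓞 k)) : IsClosed (localUInt W v) := by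
  have h2 : IsClosed {h : Matrix (Fin 4) (Fin 4) (v.adicCompletion k) |
      ∀ i j, h i j ∈ v.adicCompletionIntegers k} := by
    have : {h : Matrix (Fin 4) (Fin 4) (v.adicCompletion k) | ∀ i j, h i j ∈ v.adicCompletionIntegers k} =
        ⋂ i, ⋂ j, (fun h : Matrix (Fin 4) (Fin 4) (v.adicCompletion k) => h i j) ⁻¹'
          (v.adicCompletionIntegers k : Set (v.adicCompletion k)) := by
      ext h
      simp only [Set.mem_setOf_eq, Set.mem_iInter, Set.mem_preimage, SetLike.mem_coe]
    rw [this]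
    refine isClosed_iInter fun i => isClosed_iInter fun j => ?_
    exact (Valued.isClosed_valuationSubring _).preimage ((continuous_apply j).comp (continuous_apply i))
  exact (isClosed_localU W v).inter h2

/-- The finite-place component of an element of `GA W` depends continuously on it. -/
theorem continuous_finMat_GA (v : HeightOneSpectrum (𝓞 k)) :
    Continuous fun g : GA W => finMat v (GA.mat W g) := by
  have hc : Continuous fun a : Ad k => a.2 v :=
    (RestrictedProduct.continuous_eval (R := fun v : HeightOneSpectrum (𝓞 k) => v.adicCompletion k)
      (A := fun v => (v.adicCompletionIntegers k : Set (v.adicCompletion k))) v).comp continuous_snd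
  exact (Units.continuous_val.comp continuous_subtype_val).matrix_map hc

/-- The infinite-place component of an element of `GA W` depends continuously on it. -/
theorem continuous_infMat_GA (w : InfinitePlace k) :
    Continuous fun g : GA W => infMat w (GA.mat W g) := by
  have hc : Continuous fun a : Ad k => a.1 w :=
    (continuous_apply (A := fun w : InfinitePlace k => w.Completion) w).comp continuous_fst
  exact (Units.continuous_val.comp continuous_subtype_val).matrix_map hc

/-- The adelic box is closed in `GA W` when its local pieces are closed. -/
theorem isClosed_adelicBox (S : Finset (HeightOneSpectrum (𝓞 k)))
    (Kf : ∀ v : HeightOneSpectrum (𝓞 k), Set (Matrix (Fin 4) (Fin 4) (v.adicCompletion k)))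
    (hKf : ∀ v ∈ S, IsClosed (Kf v))
    (Ki : ∀ w : InfinitePlace k, Set (Matrix (Fin 4) (Fin 4) w.Completion))
    (hKi : ∀ w, IsClosed (Ki w)) : IsClosed (adelicBox W S Kf Ki) := by
  have heq : adelicBox W S Kf Ki =
      (⋂ w, (fun g : GA W => infMat w (GA.mat W g)) ⁻¹' Ki w) ∩
        ((⋂ v ∈ S, (fun g : GA W => finMat v (GA.mat W g)) ⁻¹' Kf v) ∩
          (⋂ v ∈ ((↑S : Set (HeightOneSpectrum (𝓞 k)))ᶜ),
            (fun g : GA W => finMat v (GA.mat W g)) ⁻¹' localUInt W v)) := by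
    ext g
    simp only [adelicBox, Set.mem_setOf_eq, Set.mem_inter_iff, Set.mem_iInter, Set.mem_preimage,
      Set.mem_compl_iff, Finset.mem_coe]
  rw [heq]
  refine (isClosed_iInter fun w => (hKi w).preimage (continuous_infMat_GA W w)).inter ?_
  refine (isClosed_biInter fun v hv => (hKf v hv).preimage (continuous_finMat_GA W v)).inter ?_
  exact isClosed_biInter fun v _ => (isClosed_localUInt W v).preimage (continuous_finMat_GA W v)

end Closed

section Compact

variable {k : Type} [Field k] [NumberField k] (W : PlaneData k)

/-- `g ↦ (g, op g⁻¹)` is inducing on `GA W` (the units topology). -/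
theorem isInducing_embedProduct_GA :
    IsInducing fun g : GA W => Units.embedProduct (M4 k) (g : GL4 k) :=
  Units.isEmbedding_embedProduct.isInducing.comp IsEmbedding.subtypeVal.isInducing

/-- The range of `g ↦ (g, op g⁻¹)` on `GA W` is closed. -/
theorem isClosed_range_embedProduct_GA :
    IsClosed (Set.range fun g : GA W => Units.embedProduct (M4 k) (g : GL4 k)) := by
  haveI := t2Space_adeleRing k
  have : (Set.range fun g : GA W => Units.embedProduct (M4 k) (g : GL4 k)) =
      Units.embedProduct (M4 k) '' ((unitaryGroup W : Subgroup (GL4 k)) : Set (GL4 k)) := by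
    rw [show (fun g : GA W => Units.embedProduct (M4 k) (g : GL4 k)) =
      Units.embedProduct (M4 k) ∘ (Subtype.val : GA W → GL4 k) from rfl, Set.range_comp,
      Subtype.range_coe]
  rw [this]
  exact Units.isClosedEmbedding_embedProduct.isClosedMap _ (isClosed_unitaryGroup W)

/-- (C7.3b) **THE ADELIC BOX IS COMPACT** in `GA W`: components in the compact `Ki w` at every infinite place, in
the compact `Kf v` at the finite places of `S`, integral (`U(W)(𝓞_v)`) at the finite places outside `S`. -/
theorem isCompact_adelicBox (hW : IsDefinite W) (S : Finset (HeightOneSpectrum (𝓞 k)))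
    (Kf : ∀ v : HeightOneSpectrum (𝓞 k), Set (Matrix (Fin 4) (Fin 4) (v.adicCompletion k)))
    (hKf : ∀ v ∈ S, IsCompact (Kf v))
    (Ki : ∀ w : InfinitePlace k, Set (Matrix (Fin 4) (Fin 4) w.Completion))
    (hKi : ∀ w, IsCompact (Ki w)) :
    IsCompact (adelicBox W S Kf Ki) := by
  classical
  -- the two entrywise boxes in `M₄(𝔸_k)`: for `g` and for `g⁻¹ = det g • adj g`
  let ev : ∀ (F : Type) [Field F], Fin 4 → Fin 4 → Matrix (Fin 4) (Fin 4) F → F :=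
    fun _ _ i j h => h i j
  let da : ∀ (F : Type) [Field F], Matrix (Fin 4) (Fin 4) F → Matrix (Fin 4) (Fin 4) F :=
    fun _ _ h => h.det • h.adjugate
  have hev : ∀ (F : Type) [Field F] [TopologicalSpace F] (i j : Fin 4), Continuous (ev F i j) :=
    fun F _ _ i j => (continuous_apply j).comp (continuous_apply i)
  have hda : ∀ (F : Type) [Field F] [TopologicalSpace F] [IsTopologicalRing F], Continuous (da F) :=
    fun F _ _ _ => continuous_id.matrix_det.smul continuous_id.matrix_adjugate
  let E1 : Fin 4 → Fin 4 → Set (Ad k) := fun i j =>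
    {a | (∀ w, a.1 w ∈ ev w.Completion i j '' Ki w) ∧ (∀ v ∈ S, a.2 v ∈ ev (v.adicCompletion k) i j '' Kf v) ∧
      ∀ v ∉ S, a.2 v ∈ v.adicCompletionIntegers k}
  let E2 : Fin 4 → Fin 4 → Set (Ad k) := fun i j =>
    {a | (∀ w, a.1 w ∈ ev w.Completion i j '' (da w.Completion '' Ki w)) ∧
      (∀ v ∈ S, a.2 v ∈ ev (v.adicCompletion k) i j '' (da (v.adicCompletion k) '' Kf v)) ∧
      ∀ v ∉ S, a.2 v ∈ v.adicCompletionIntegers k}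
  have hE1 : ∀ i j, IsCompact (E1 i j) := fun i j =>
    isCompact_adele_box k S _ (fun v hv => (hKf v hv).image (hev _ i j)) _
      (fun w => (hKi w).image (hev _ i j))
  have hE2 : ∀ i j, IsCompact (E2 i j) := fun i j =>
    isCompact_adele_box k S _ (fun v hv => ((hKf v hv).image (hda _)).image (hev _ i j)) _
      (fun w => ((hKi w).image (hda _)).image (hev _ i j))
  have hKb1 := isCompact_matrix_box k E1 hE1
  have hKb2 := isCompact_matrix_box k E2 hE2
  have hKbig : IsCompact ({A : M4 k | ∀ i j, A i j ∈ E1 i j} ×ˢ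
      (MulOpposite.op '' {A : M4 k | ∀ i j, A i j ∈ E2 i j})) :=
    hKb1.prod (hKb2.image MulOpposite.continuous_op)
  -- the box is a closed subset of the preimage of the big compact
  have hpre := (isInducing_embedProduct_GA W).isCompact_preimage (isClosed_range_embedProduct_GA W) hKbig
  refine hpre.of_isClosed_subset ?_ ?_
  · exact isClosed_adelicBox W S Kf (fun v hv => (hKf v hv).isClosed) Ki (fun w => (hKi w).isClosed)
  · intro g hg
    obtain ⟨hgi, hgf, hgint⟩ := hg
    refine ⟨?_, ?_⟩
    · intro i j
      refine ⟨fun w => ⟨infMat w (GA.mat W g), hgi w, rfl⟩, fun v hv => ⟨finMat v (GA.mat W g), hgf v hv, rfl⟩,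
        fun v hv => (hgint v hv).2 i j⟩
    · refine ⟨GA.mat W g⁻¹, ?_, rfl⟩
      intro i j
      refine ⟨fun w => ?_, fun v hv => ?_, fun v hv => ?_⟩
      · refine ⟨da w.Completion (infMat w (GA.mat W g)), ⟨infMat w (GA.mat W g), hgi w, rfl⟩, ?_⟩
        show (infMat w (GA.mat W g)).det • (infMat w (GA.mat W g)).adjugate i j = infMat w (GA.mat W g⁻¹) i j
        rw [infMat_GA_inv, inv_eq_of_mem_localUInf W hW w (infMat_mem_localUInf W g w)]
        rfl
      · refine ⟨da (v.adicCompletion k) (finMat v (GA.mat W g)), ⟨finMat v (GA.mat W g), hgf v hv, rfl⟩, ?_⟩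
        show (finMat v (GA.mat W g)).det • (finMat v (GA.mat W g)).adjugate i j = finMat v (GA.mat W g⁻¹) i j
        rw [finMat_GA_inv, inv_eq_of_mem_localU W hW v (finMat_mem_localU W g v)]
        rfl
      · show finMat v (GA.mat W g⁻¹) i j ∈ v.adicCompletionIntegers k
        rw [finMat_GA_inv, inv_eq_of_mem_localU W hW v (finMat_mem_localU W g v)]
        exact det_smul_adjugate_mem_integers v (hgint v hv).2 i j

end Compact

end Summit.Ventures.HodgeRepro.Tier4.Line1
end
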